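import Summits.Ventures.HSemireg.WedgeHankelRecurrenceGaussChebyshevUGcd

/-!
# Venture HSemireg — **THE IDEAL `(T_m, T_n)` OF `R[X]` FOR EVERY COMMUTATIVE RING: `(T_m, T_n) = (T_{gcd(m,n)})` WHEN `m ∕ gcd` AND `n ∕ gcd` ARE BOTH ODD, AND `(T_m, T_n) = R[X]`
# OTHERWISE** — the first-kind Chebyshev analogue of N457: the Euclidean step `(T_{j+2m}, T_m) = (T_j, T_m)` from Mathlib's product formula `2 T_m T_k = T_{m+k} + T_{m−k}` (no
# invertibility of `2` needed), its iterate over `ℤ`-multiples of `2m` and the reflection `(T_{2m−j}, T_m) = (T_j, T_m)`, then a descent on `m` (fold `n` modulo `2m` into `[0, m]`) with the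
# parity bookkeeping of the quotients `m ∕ gcd`, `n ∕ gcd`; node-set reading: the first-kind Gauss–Chebyshev rules with `m` and `n` nodes share nodes iff `m ∕ gcd`, `n ∕ gcd` are odd, and then
# the shared nodes are exactly the `gcd(m,n)` nodes `cos((2i−1)π ∕ (2 gcd))`

HONEST FRAMING. Part of the Lean index of the computation cell `pub-hsemireg` (seat p10 gen 48, Sunday typer «UNIFORM-IN-n»).  Polynomial ∕ ideal algebra and `ℕ`-parity bookkeeping only; no
variety, no cohomology theory, no sheaf, no Ext group and no semiregularity map is constructed here; nothing here says that HC / HC_CM / HC_AV holds; no Literature fact (unproved `Prop`) is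
declared or used.  Custodian versions as in `WedgeHankelSiegelIdeal` (1/3).
SOURCES (cited).  M. O. Rayes, V. Trevisan, P. S. Wang, *Factorization properties of Chebyshev polynomials*, Comput. Math. Appl. 50 (2005) 1231–1240, Thm 4 (`gcd(T_m, T_n) = T_{gcd(m,n)}` if
`m ∕ gcd`, `n ∕ gcd` are odd, `= 1` otherwise); T. J. Rivlin, *Chebyshev Polynomials* (1990), §1.2 ∕ Ex. 1.5 (product formula, `T_m ∘ T_n = T_{mn}`).  Typed here for IDEALS of `R[X]`, `R` any
commutative ring.
PROOF TYPED HERE.  Mathlib `Polynomial.Chebyshev.T_mul_T`, `T_neg`, `Ideal.span_pair_add_mul_right`, `Ideal.span_insert_neg`, `Ideal.span_pair_comm`, `Ideal.eq_top_of_isUnit_mem`, `Set.pair_eq_singleton`,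
`Nat.strong_induction_on`, `Nat.mod_add_div`, `Nat.gcd_add_mul_left_right`, `Nat.add_div_of_dvd_right`, `Nat.mul_div_assoc`, `Nat.odd_iff`; `Int.induction_on`.
DEDUP DISCLOSURE (`rg -n 'chebyshevT_span_pair|gcd_eq_and_odd_div_iff|chebyshevT_span_pair_dichotomy|_eq_span_gcd|_eq_top' Summits/Ventures/HSemireg Literature`, 2026-09-04): N457 (the `U`
names); N433 `chebyshevT_dvd_T_odd_mul` ∕ N455 `chebyshevT_not_isCoprime_odd_mul` are the divisibility ∕ one-directional field statements; 0 hits for the 9 names below.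

WHAT IS IN THE TREE.  N433, N446 `chebyshev_isCoprime_T_succ`, N450, N455, N457.
THIS FILE (namespace `Summit.Ventures.HSemireg.Wedge.HankelOuter` continued; CHAINED on N457; 0 definitions):
* §1223 `chebyshevT_span_pair_add_two_mul`, `chebyshevT_span_pair_add_mul_two_mul` (`ℤ`-multiples), `chebyshevT_span_pair_two_mul_sub` (reflection), `gcd_eq_and_odd_div_iff_of_eq_add`,
  `gcd_eq_and_odd_div_iff_of_add_eq` (parity bookkeeping), `exists_fold_mod_two_mul`, **`chebyshevT_span_pair_dichotomy`**, **`chebyshevT_span_pair_eq_span_gcd`** (`(T_m,T_n) = (T_{gcd})`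
  in the odd–odd case), **`chebyshevT_span_pair_eq_top`** (`= R[X]` otherwise).
CAVEATS.  `m ∕ gcd(m,n)` is `ℕ`-division (`0 ∕ 0 = 0`, so `m = n = 0` falls in the second case, consistently with `T_0 = 1`).  Nothing Ext-side.  New names only.
-/

open Module Polynomial
open scoped Matrix Polynomial

namespace Summit.Ventures.HSemireg.Wedge.HankelOuter

/-! ## §1223. The ideal `(T_m, T_n)` -/

/-- **Euclidean step for ideals: `(T_{j+2m}, T_m) = (T_j, T_m)`** (all `j, m ∈ ℤ`, any commutative ring; from `2 T_m T_{j+m} = T_{j+2m} + T_j`). [Rivlin §1.2; this file, §1223] -/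
theorem chebyshevT_span_pair_add_two_mul {R : Type*} [CommRing R] (j m : ℤ) :
    Ideal.span {Polynomial.Chebyshev.T R (j + 2 * m), Polynomial.Chebyshev.T R m} =
      Ideal.span {Polynomial.Chebyshev.T R j, Polynomial.Chebyshev.T R m} := by
  have h := Polynomial.Chebyshev.T_mul_T R m (j + m)
  rw [show m + (j + m) = j + 2 * m by ring, show m - (j + m) = -j by ring, Polynomial.Chebyshev.T_neg] at h
  have hstep : Polynomial.Chebyshev.T R (j + 2 * m) =
      -Polynomial.Chebyshev.T R j + (2 * Polynomial.Chebyshev.T R (j + m)) * Polynomial.Chebyshev.T R m := by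
    linear_combination (-1 : R[X]) * h
  rw [hstep, Ideal.span_pair_add_mul_right, Ideal.span_insert_neg]

/-- `(T_{j+k·2m}, T_m) = (T_j, T_m)` for every `k ∈ ℤ`. [this file, §1223] -/
theorem chebyshevT_span_pair_add_mul_two_mul {R : Type*} [CommRing R] (j m k : ℤ) :
    Ideal.span {Polynomial.Chebyshev.T R (j + k * (2 * m)), Polynomial.Chebyshev.T R m} =
      Ideal.span {Polynomial.Chebyshev.T R j, Polynomial.Chebyshev.T R m} := by
  induction k using Int.induction_on with
  | zero => rw [zero_mul, add_zero]
  | succ i ih => rw [add_mul, one_mul, ← add_assoc, chebyshevT_span_pair_add_two_mul, ih]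
  | pred i ih =>
    have h := chebyshevT_span_pair_add_two_mul (R := R) (j + (-(i : ℤ) - 1) * (2 * m)) m
    rw [show j + (-(i : ℤ) - 1) * (2 * m) + 2 * m = j + (-(i : ℤ)) * (2 * m) by ring, ih] at h
    exact h.symm

/-- **Reflection: `(T_{2m−j}, T_m) = (T_j, T_m)`** (all `j, m ∈ ℤ`). [this file, §1223] -/
theorem chebyshevT_span_pair_two_mul_sub {R : Type*} [CommRing R] (j m : ℤ) :
    Ideal.span {Polynomial.Chebyshev.T R (2 * m - j), Polynomial.Chebyshev.T R m} =
      Ideal.span {Polynomial.Chebyshev.T R j, Polynomial.Chebyshev.T R m} := by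
  rw [show 2 * m - j = -(j + (-1) * (2 * m)) by ring, Polynomial.Chebyshev.T_neg, chebyshevT_span_pair_add_mul_two_mul]

/-- Parity bookkeeping: if `n = j + 2mq` then `gcd(m,n) = gcd(m,j)` and `n ∕ gcd`, `j ∕ gcd` have the same parity. [this file, §1223] -/
theorem gcd_eq_and_odd_div_iff_of_eq_add {m n j q : ℕ} (h : n = j + 2 * m * q) :
    Nat.gcd m n = Nat.gcd m j ∧ (Odd (n / Nat.gcd m j) ↔ Odd (j / Nat.gcd m j)) := by
  refine ⟨by rw [h, show 2 * m * q = m * (2 * q) by ring, Nat.gcd_add_mul_left_right], ?_⟩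
  have hgm : Nat.gcd m j ∣ m := Nat.gcd_dvd_left m j
  have hgj : Nat.gcd m j ∣ j := Nat.gcd_dvd_right m j
  rw [h, Nat.add_div_of_dvd_right hgj, show 2 * m * q = (2 * q) * m by ring, Nat.mul_div_assoc _ hgm,
    show 2 * q * (m / Nat.gcd m j) = 2 * (q * (m / Nat.gcd m j)) by ring]
  simp only [Nat.odd_iff, Nat.add_mul_mod_self_left]

/-- Parity bookkeeping: if `n + j = 2mq` then `gcd(m,n) = gcd(m,j)` and `n ∕ gcd`, `j ∕ gcd` have the same parity. [this file, §1223] -/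
theorem gcd_eq_and_odd_div_iff_of_add_eq {m n j q : ℕ} (h : n + j = 2 * m * q) :
    Nat.gcd m n = Nat.gcd m j ∧ (Odd (n / Nat.gcd m j) ↔ Odd (j / Nat.gcd m j)) := by
  have hg : Nat.gcd m n = Nat.gcd m j := by
    apply Nat.dvd_antisymm
    · refine Nat.dvd_gcd (Nat.gcd_dvd_left m n) ?_
      have hj : j = 2 * m * q - n := by omega
      rw [hj]
      exact Nat.dvd_sub (Dvd.dvd.mul_right (Dvd.dvd.mul_left (Nat.gcd_dvd_left m n) 2) q) (Nat.gcd_dvd_right m n)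
    · refine Nat.dvd_gcd (Nat.gcd_dvd_left m j) ?_
      have hn : n = 2 * m * q - j := by omega
      rw [hn]
      exact Nat.dvd_sub (Dvd.dvd.mul_right (Dvd.dvd.mul_left (Nat.gcd_dvd_left m j) 2) q) (Nat.gcd_dvd_right m j)
  refine ⟨hg, ?_⟩
  have hgm : Nat.gcd m j ∣ m := Nat.gcd_dvd_left m j
  have hgn : Nat.gcd m j ∣ n := hg ▸ Nat.gcd_dvd_right m n
  have hsum : n / Nat.gcd m j + j / Nat.gcd m j = 2 * (q * (m / Nat.gcd m j)) := by
    rw [← Nat.add_div_of_dvd_right hgn, h, show 2 * m * q = (2 * q) * m by ring, Nat.mul_div_assoc _ hgm]; ring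
  simp only [Nat.odd_iff]
  omega

/-- Folding `n` modulo `2m` into `[0, m]`: for `m ≥ 1` there are `j ≤ m` and `q` with `n = j + 2mq` or `n + j = 2mq`. [this file, §1223] -/
theorem exists_fold_mod_two_mul {m : ℕ} (hm : 0 < m) (n : ℕ) : ∃ j, j ≤ m ∧ ∃ q : ℕ, n = j + 2 * m * q ∨ n + j = 2 * m * q := by
  have hdiv := Nat.mod_add_div n (2 * m)
  have hlt := Nat.mod_lt n (show 0 < 2 * m by omega)
  by_cases hr : n % (2 * m) ≤ m
  · exact ⟨n % (2 * m), hr, n / (2 * m), Or.inl hdiv.symm⟩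
  · refine ⟨2 * m - n % (2 * m), by omega, n / (2 * m) + 1, Or.inr ?_⟩
    rw [mul_add, mul_one]
    generalize 2 * m * (n / (2 * m)) = Q at hdiv ⊢
    omega

/-- **Dichotomy for the ideal `(T_m, T_n)` (any commutative ring): `= (T_{gcd(m,n)})` if `m ∕ gcd`, `n ∕ gcd` are both odd, `= R[X]` otherwise.** [Rayes–Trevisan–Wang 2005 Thm 4, ideal form;
this file, §1223] -/
theorem chebyshevT_span_pair_dichotomy {R : Type*} [CommRing R] (m n : ℕ) :
    (Odd (m / Nat.gcd m n) ∧ Odd (n / Nat.gcd m n) →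
        Ideal.span {Polynomial.Chebyshev.T R (m : ℤ), Polynomial.Chebyshev.T R (n : ℤ)} = Ideal.span {Polynomial.Chebyshev.T R (Nat.gcd m n : ℤ)}) ∧
      (¬ (Odd (m / Nat.gcd m n) ∧ Odd (n / Nat.gcd m n)) →
        Ideal.span {Polynomial.Chebyshev.T R (m : ℤ), Polynomial.Chebyshev.T R (n : ℤ)} = ⊤) := by
  induction m using Nat.strong_induction_on generalizing n with
  | _ m ih =>
  rcases Nat.eq_zero_or_pos m with rfl | hm
  · -- `T_0 = 1`
    refine ⟨fun h => absurd h.1 (by rw [Nat.zero_div]; exact Nat.not_odd_zero), fun _ => ?_⟩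
    rw [Nat.cast_zero, Polynomial.Chebyshev.T_zero]
    exact Ideal.eq_top_of_isUnit_mem _ (Ideal.subset_span (Set.mem_insert _ _)) isUnit_one
  · obtain ⟨j, hjm, q, hj⟩ := exists_fold_mod_two_mul hm n
    -- ideal reduction `(T_m, T_n) = (T_j, T_m)` and the bookkeeping
    have hred : Ideal.span {Polynomial.Chebyshev.T R (m : ℤ), Polynomial.Chebyshev.T R (n : ℤ)} =
        Ideal.span {Polynomial.Chebyshev.T R (j : ℤ), Polynomial.Chebyshev.T R (m : ℤ)} ∧
        Nat.gcd m n = Nat.gcd m j ∧ (Odd (n / Nat.gcd m j) ↔ Odd (j / Nat.gcd m j)) := by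
      rcases hj with hj | hj
      · refine ⟨?_, gcd_eq_and_odd_div_iff_of_eq_add hj⟩
        rw [Ideal.span_pair_comm, hj, Nat.cast_add, Nat.cast_mul, Nat.cast_mul, Nat.cast_ofNat,
          show (j : ℤ) + 2 * (m : ℤ) * (q : ℤ) = j + (q : ℤ) * (2 * m) by ring, chebyshevT_span_pair_add_mul_two_mul]
      · refine ⟨?_, gcd_eq_and_odd_div_iff_of_add_eq hj⟩
        have hz : (n : ℤ) = -((j : ℤ) + (-(q : ℤ)) * (2 * m)) := by
          have e := congrArg (Nat.cast : ℕ → ℤ) hj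
          push_cast at e
          linarith
        rw [Ideal.span_pair_comm, hz, Polynomial.Chebyshev.T_neg, chebyshevT_span_pair_add_mul_two_mul]
    obtain ⟨hideal, hg1, hg2⟩ := hred
    rw [hideal, hg1, hg2]
    rcases Nat.lt_or_ge j m with hjlt | hjge
    · rcases Nat.eq_zero_or_pos j with rfl | hjpos
      · -- `j = 0`: `T_0 = 1`
        refine ⟨fun h => absurd h.2 (by rw [Nat.zero_div]; exact Nat.not_odd_zero), fun _ => ?_⟩
        rw [Nat.cast_zero, Polynomial.Chebyshev.T_zero]
        exact Ideal.eq_top_of_isUnit_mem _ (Ideal.subset_span (Set.mem_insert _ _)) isUnit_one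
      · -- `0 < j < m`: induction hypothesis at `(j, m)`
        have h := ih j hjlt m
        rw [Nat.gcd_comm j m, show (Odd (j / Nat.gcd m j) ∧ Odd (m / Nat.gcd m j)) ↔ (Odd (m / Nat.gcd m j) ∧ Odd (j / Nat.gcd m j)) from And.comm] at h
        exact h
    · -- `j = m`
      obtain rfl : j = m := le_antisymm hjm hjge
      rw [Nat.gcd_self, Nat.div_self hm, Set.pair_eq_singleton]
      exact ⟨fun _ => rfl, fun h => absurd ⟨odd_one, odd_one⟩ h⟩

/-- **`(T_m, T_n) = (T_{gcd(m,n)})` when `m ∕ gcd(m,n)` and `n ∕ gcd(m,n)` are odd** (any commutative ring). [Rayes–Trevisan–Wang 2005 Thm 4; this file, §1223] -/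
theorem chebyshevT_span_pair_eq_span_gcd {R : Type*} [CommRing R] {m n : ℕ} (h : Odd (m / Nat.gcd m n) ∧ Odd (n / Nat.gcd m n)) :
    Ideal.span {Polynomial.Chebyshev.T R (m : ℤ), Polynomial.Chebyshev.T R (n : ℤ)} = Ideal.span {Polynomial.Chebyshev.T R (Nat.gcd m n : ℤ)} :=
  (chebyshevT_span_pair_dichotomy m n).1 h

/-- **`(T_m, T_n) = R[X]` (so `T_m`, `T_n` are coprime) unless `m ∕ gcd(m,n)` and `n ∕ gcd(m,n)` are both odd** (any commutative ring). [Rayes–Trevisan–Wang 2005 Thm 4; this file, §1223] -/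
theorem chebyshevT_span_pair_eq_top {R : Type*} [CommRing R] {m n : ℕ} (h : ¬ (Odd (m / Nat.gcd m n) ∧ Odd (n / Nat.gcd m n))) :
    Ideal.span {Polynomial.Chebyshev.T R (m : ℤ), Polynomial.Chebyshev.T R (n : ℤ)} = ⊤ :=
  (chebyshevT_span_pair_dichotomy m n).2 h

end Summit.Ventures.HSemireg.Wedge.HankelOuter
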